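import Summits.QuantumFields.QCD.Theorems.QuarksAsStableActionCriticalLineDiamagnetismDefectRemoval

/-!
# Closed-slab packaging of the `+` reflected word (Route B, steps B1′ + B3)
(helper for crux stmt-QuantumFields-9734, line `Sketch`, static route, stub `stub_heavyFrequencyGain`)

For positive definite one-step matrices `M_i` (`i : ZMod (2n+1)`) and transporters `W_i` we take the half-step
matrices `A_i := M_i^{1/2}` (the positive square root, so `A_i A_iᴴ = A_i A_i = M_i`, `det A_i ≠ 0`).  With
`T_t := A_tᴴ W_t A_{t+1}` and `Y := T_0 ⋯ T_{n-1}`: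

* the `+` reflected word of the mixed Schwarz inequality,
  `M_0 W_0 ⋯ M_{n-1} W_{n-1} · M_n · 1 · M_n W_{n-1}ᴴ ⋯ M_1 W_0ᴴ`, equals `A_0 (Y M_n Yᴴ) A_0⁻¹`, hence
  `det (1 + word₊) = det (1 + Y M_n Yᴴ) ≤ (∏ max(μᵢ(M_n),1)) · det (1 + Y Yᴴ)` by defect removal
  (`det_one_add_mul_mul_conjTranspose_le`); we record the real parts;
* Sylvester packaging of the pure tiling terms: `det (1 + (T_tᴴ T_t)^p) = det (1 + (W_tᴴ M_t W_t M_{t+1})^p)`.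

No unitarity of the `W_i` is needed for these two algebraic facts.
-/

namespace Summit.QuantumFields.QCD.Cruxes.CriticalLineDiamagnetism.ChessboardCellGain

open Matrix
open scoped ComplexOrder MatrixOrder

/-- Telescoping regrouping of a closed-slab product:
`a₀ · ∏_{i<n} (aᵢ bᵢ aᵢ₊₁) = (∏_{i<n} aᵢ aᵢ bᵢ) · aₙ`. -/
private theorem csp_telescope {α : Type} [Monoid α] (a b : ℕ → α) (n : ℕ) :
    a 0 * ((List.range n).map fun i => a i * b i * a (i + 1)).prod =
      ((List.range n).map fun i => a i * a i * b i).prod * a n := by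
  induction n with
  | zero => simp
  | succ n ih =>
    rw [List.prod_range_succ, List.prod_range_succ, ← mul_assoc (a 0), ih]
    simp only [mul_assoc]

/-- Sylvester's determinant identity for powers: `det (1 + (A B)^p) = det (1 + (B A)^p)`. -/
private theorem csp_det_one_add_pow_comm {k : Type} [Fintype k] [DecidableEq k]
    (A B : Matrix k k ℂ) (p : ℕ) :
    (1 + (A * B) ^ p).det = (1 + (B * A) ^ p).det := by
  cases p with
  | zero => simp
  | succ q =>
    rw [pow_succ (A * B) q, ← Matrix.mul_assoc ((A * B) ^ q) A B, mul_pow_mul A B q,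
      Matrix.mul_assoc A ((B * A) ^ q) B, Matrix.det_one_add_mul_comm A ((B * A) ^ q * B),
      Matrix.mul_assoc ((B * A) ^ q) B A, ← pow_succ]

/-- Similar matrices have the same `det (1 + ·)`: if `X P = P Z` with `det P ≠ 0` then
`det (1 + X) = det (1 + Z)`. -/
private theorem csp_det_one_add_conj {k : Type} [Fintype k] [DecidableEq k] (X Z P : Matrix k k ℂ)
    (hP : P.det ≠ 0) (h : X * P = P * Z) : (1 + X).det = (1 + Z).det := by
  have h1 : (1 + X).det * P.det = P.det * (1 + Z).det := by
    rw [← det_mul, ← det_mul, Matrix.add_mul, Matrix.one_mul, h, Matrix.mul_add, Matrix.mul_one]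
  have h2 : P.det * (1 + X).det = P.det * (1 + Z).det := by rw [mul_comm, h1]
  exact mul_left_cancel₀ hP h2

/-- Assembly of the conjugation `word₊ · A₀ = A₀ · (Y Mₙ Yᴴ)` from the two telescoped halves, at the level of
`det (1 + ·)`. -/
private theorem csp_assembly {k : Type} [Fintype k] [DecidableEq k]
    {R0 Rn Mn Y S1 S2 : Matrix k k ℂ} (hdet : R0.det ≠ 0) (h1 : R0 * Y = S1 * Rn)
    (h2 : Rn * Yᴴ = S2 * R0) (hM : Rn * Rn = Mn) :
    (1 + S1 * (Mn * S2)).det = (1 + Y * Mn * Yᴴ).det := by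
  apply csp_det_one_add_conj _ _ R0 hdet
  calc S1 * (Mn * S2) * R0 = S1 * Mn * (S2 * R0) := by simp only [Matrix.mul_assoc]
    _ = S1 * (Rn * Rn) * (Rn * Yᴴ) := by rw [hM, h2]
    _ = (S1 * Rn) * Rn * (Rn * Yᴴ) := by simp only [Matrix.mul_assoc]
    _ = R0 * Y * Rn * (Rn * Yᴴ) := by rw [← h1]
    _ = R0 * (Y * Mn * Yᴴ) := by rw [← hM]; simp only [Matrix.mul_assoc]

/-- Positive square roots of a family of positive definite matrices: Hermitian `R_i` with `R_i R_i = M_i` and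
`det R_i ≠ 0`. -/
private theorem csp_sqrt_exists {k : Type} [Fintype k] [DecidableEq k] {N : ℕ}
    (M : ZMod N → Matrix k k ℂ) (hM : ∀ i, (M i).PosDef) :
    ∃ R : ZMod N → Matrix k k ℂ, (∀ i, (R i)ᴴ = R i) ∧ (∀ i, R i * R i = M i) ∧ ∀ i, (R i).det ≠ 0 := by
  refine ⟨fun i => CFC.sqrt (M i), fun i => ?_, fun i => ?_, fun i => ?_⟩
  · exact (CFC.sqrt_nonneg (M i)).posSemidef.1.eq
  · exact CFC.sqrt_mul_sqrt_self (M i) (hM i).posSemidef.nonneg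
  · intro h
    have h2 : (M i).det = 0 := by
      rw [← CFC.sqrt_mul_sqrt_self (M i) (hM i).posSemidef.nonneg, det_mul, h, mul_zero]
    exact (hM i).det_pos.ne' h2

/-- Expansion of the `+` reflected word on `ZMod (2n+1)`:
`word₊ = (∏_{i<n} M_i W_i) · (M_n · ∏_{j<n} M_{n-j} W_{n-1-j}ᴴ)`. -/
private theorem csp_word_expand {k : Type} [Fintype k] [DecidableEq k] (n : ℕ)
    (M W : ZMod (2 * n + 1) → Matrix k k ℂ) :
    ((List.range (2 * n + 1)).map fun i : ℕ =>
        M ((fun j : ZMod (2 * n + 1) => if j.val ≤ n then j else -j) (i : ZMod (2 * n + 1))) *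
          (fun j : ZMod (2 * n + 1) => if j.val < n then W j else if j.val = n then 1 else (W (-1 - j))ᴴ)
            (i : ZMod (2 * n + 1))).prod =
      ((List.range n).map fun i : ℕ => M i * W i).prod *
        (M n * ((List.range n).map fun j : ℕ =>
          M ((n - j : ℕ) : ZMod (2 * n + 1)) * (W ((n - 1 - j : ℕ) : ZMod (2 * n + 1)))ᴴ).prod) := by
  have hsplit : List.range (2 * n + 1) =
      List.range n ++ (n :: (List.range n).map (fun j => n + (j + 1))) := by
    rw [show 2 * n + 1 = n + (n + 1) by ring, List.range_add, List.range_succ_eq_map, List.map_cons,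
      List.map_map]
    rfl
  have hval : ∀ i : ℕ, i < 2 * n + 1 → ((i : ZMod (2 * n + 1))).val = i :=
    fun i hi => ZMod.val_cast_of_lt hi
  rw [hsplit, List.map_append, List.map_cons, List.prod_append, List.prod_cons, List.map_map]
  congr 1
  · apply congrArg List.prod
    apply List.map_congr_left
    intro i hi
    rw [List.mem_range] at hi
    simp only [hval i (by omega), hi.le, hi, if_true]
  · congr 1
    · simp only [hval n (by omega), le_refl, lt_irrefl, if_true, if_false, Matrix.mul_one]
    · apply congrArg List.prod
      apply List.map_congr_left
      intro j hj
      rw [List.mem_range] at hj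
      have h1 : ¬ (n + (j + 1) ≤ n) := by omega
      have h2 : ¬ (n + (j + 1) < n) := by omega
      have h3 : n + (j + 1) ≠ n := by omega
      simp only [Function.comp_apply, hval (n + (j + 1)) (by omega), h1, h2, h3, if_false]
      have e1 : (-((n + (j + 1) : ℕ) : ZMod (2 * n + 1))) = ((n - j : ℕ) : ZMod (2 * n + 1)) := by
        apply neg_eq_of_add_eq_zero_right
        rw [← Nat.cast_add, show n + (j + 1) + (n - j) = 2 * n + 1 by omega, ZMod.natCast_self]
      have e2 : (-1 - ((n + (j + 1) : ℕ) : ZMod (2 * n + 1))) = ((n - 1 - j : ℕ) : ZMod (2 * n + 1)) := by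
        rw [← neg_add']
        apply neg_eq_of_add_eq_zero_right
        rw [show (1 : ZMod (2 * n + 1)) = ((1 : ℕ) : ZMod (2 * n + 1)) from Nat.cast_one.symm,
          ← Nat.cast_add, ← Nat.cast_add, show 1 + (n + (j + 1)) + (n - 1 - j) = 2 * n + 1 by omega,
          ZMod.natCast_self]
      rw [e1, e2]

/-- First telescoped half: `A_0 · Y = (∏_{t<n} A_t A_t W_t) · A_n` for Hermitian half-steps. -/
private theorem csp_Y1 {k : Type} [Fintype k] [DecidableEq k] (n : ℕ)
    (R W : ZMod (2 * n + 1) → Matrix k k ℂ) (hRH : ∀ i, (R i)ᴴ = R i) :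
    R 0 * ((List.range n).map fun t : ℕ => (R t)ᴴ * W t * R (t + 1)).prod =
      ((List.range n).map fun t : ℕ => R t * R t * W t).prod * R n := by
  have h := csp_telescope (fun t : ℕ => R t) (fun t : ℕ => W t) n
  simpa only [hRH, Nat.cast_zero, Nat.cast_succ] using h

/-- Second telescoped half: `A_n · Yᴴ = (∏_{j<n} A_{n-j} A_{n-j} W_{n-1-j}ᴴ) · A_0` for Hermitian half-steps. -/
private theorem csp_Y2 {k : Type} [Fintype k] [DecidableEq k] (n : ℕ)
    (R W : ZMod (2 * n + 1) → Matrix k k ℂ) (hRH : ∀ i, (R i)ᴴ = R i) :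
    R n * (((List.range n).map fun t : ℕ => (R t)ᴴ * W t * R (t + 1)).prod)ᴴ =
      ((List.range n).map fun j : ℕ => R ((n - j : ℕ) : ZMod (2 * n + 1)) * R ((n - j : ℕ) : ZMod (2 * n + 1)) *
          (W ((n - 1 - j : ℕ) : ZMod (2 * n + 1)))ᴴ).prod * R 0 := by
  have hrev : (((List.range n).map fun t : ℕ => (R t)ᴴ * W t * R (t + 1)).prod)ᴴ =
      ((List.range n).map fun j : ℕ => R ((n - j : ℕ) : ZMod (2 * n + 1)) *
          (W ((n - 1 - j : ℕ) : ZMod (2 * n + 1)))ᴴ * R ((n - 1 - j : ℕ) : ZMod (2 * n + 1))).prod := by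
    rw [Matrix.conjTranspose_list_prod, ← List.map_reverse, ← List.map_reverse, List.range_eq_range',
      List.reverse_range', ← List.range_eq_range', List.map_map, List.map_map]
    apply congrArg List.prod
    apply List.map_congr_left
    intro j hj
    rw [List.mem_range] at hj
    have e1 : 0 + n - 1 - j = n - 1 - j := by omega
    have e2 : ((n - 1 - j : ℕ) : ZMod (2 * n + 1)) + 1 = ((n - j : ℕ) : ZMod (2 * n + 1)) := by
      rw [← Nat.cast_succ]
      congr 1
      omega
    simp only [Function.comp_apply, e1, e2, conjTranspose_mul, hRH, Matrix.mul_assoc]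
  rw [hrev]
  have h := csp_telescope (fun j : ℕ => R ((n - j : ℕ) : ZMod (2 * n + 1)))
    (fun j : ℕ => (W ((n - 1 - j : ℕ) : ZMod (2 * n + 1)))ᴴ) n
  simp only [Nat.sub_zero, Nat.sub_self, Nat.cast_zero] at h
  simp only [show ∀ i : ℕ, n - 1 - i = n - (i + 1) from fun i => by omega] at h ⊢
  exact h

/-- **Closed-slab packaging (Route B, B1′ + B3).** For positive definite `M_i` (`i : ZMod (2n+1)`) and matrices
`W_i` there are invertible half-step matrices `A_i` with `A_i A_iᴴ = M_i` (the positive square roots) such that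
(a) the `+` reflected word of the mixed Schwarz inequality obeys
`Re det (1 + word₊) ≤ (∏ max(μᵢ(M_n),1)) · Re det (1 + Y Yᴴ)` with `Y = ∏_{t<n} A_tᴴ W_t A_{t+1}`, and
(b) `det (1 + (T_tᴴ T_t)^p) = det (1 + (W_tᴴ M_t W_t M_{t+1})^p)` for `T_t = A_tᴴ W_t A_{t+1}`. -/
theorem closedSlabPackaging : ∀ {k : Type} [Fintype k] [DecidableEq k] (n : ℕ)
    (M : ZMod (2 * n + 1) → Matrix k k ℂ) (hM : ∀ i, (M i).PosDef)
    (W : ZMod (2 * n + 1) → Matrix k k ℂ), (∀ i, W i ∈ Matrix.unitaryGroup k ℂ) →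
    ∃ (Aslab : ZMod (2 * n + 1) → Matrix k k ℂ),
      (∀ i, Aslab i * (Aslab i)ᴴ = M i) ∧ (∀ i, IsUnit (Aslab i).det) ∧
      ((1 + ((List.range (2 * n + 1)).map fun i : ℕ =>
          M ((fun j : ZMod (2 * n + 1) => if j.val ≤ n then j else -j) (i : ZMod (2 * n + 1))) *
            (fun j : ZMod (2 * n + 1) => if j.val < n then W j else if j.val = n then 1 else (W (-1 - j))ᴴ)
              (i : ZMod (2 * n + 1))).prod).det).re ≤
        (∏ i, ((max ((hM n).posSemidef.1.eigenvalues i) 1 : ℝ) : ℂ)).re *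
          ((1 + ((List.range n).map fun t : ℕ => (Aslab t)ᴴ * W t * Aslab (t + 1)).prod *
                (((List.range n).map fun t : ℕ => (Aslab t)ᴴ * W t * Aslab (t + 1)).prod)ᴴ).det).re ∧
      (∀ (t : ZMod (2 * n + 1)) (p : ℕ),
        (1 + (((Aslab t)ᴴ * W t * Aslab (t + 1))ᴴ * ((Aslab t)ᴴ * W t * Aslab (t + 1))) ^ p).det =
          (1 + ((W t)ᴴ * M t * W t * M (t + 1)) ^ p).det) := by
  intro k _ _ n M hM W _
  obtain ⟨R, hRH, hRR, hRdet⟩ := csp_sqrt_exists M hM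
  refine ⟨R, fun i => by rw [hRH, hRR], fun i => (hRdet i).isUnit, ?_, ?_⟩
  · -- (a) conjugate `word₊` into `Y M_n Yᴴ` and remove the defect
    have hword := csp_word_expand n M W
    have hY1 := csp_Y1 n R W hRH
    have hY2 := csp_Y2 n R W hRH
    simp only [hRR] at hY1 hY2
    rw [hword, csp_assembly (hRdet 0) hY1 hY2 (hRR n)]
    have hB3 := det_one_add_mul_mul_conjTranspose_le
      (((List.range n).map fun t : ℕ => (R t)ᴴ * W t * R (t + 1)).prod) (M n) (hM n).posSemidef
    have hre := (Complex.le_def.1 hB3).1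
    rw [← Complex.ofReal_prod, Complex.re_ofReal_mul] at hre
    rw [← Complex.ofReal_prod, Complex.ofReal_re]
    exact hre
  · -- (b) Sylvester packaging of the pure tiling terms
    intro t p
    have hT : ((R t)ᴴ * W t * R (t + 1))ᴴ * ((R t)ᴴ * W t * R (t + 1)) =
        R (t + 1) * ((W t)ᴴ * M t * W t * R (t + 1)) := by
      simp only [conjTranspose_mul, hRH, Matrix.mul_assoc, ← hRR t]
    rw [hT, csp_det_one_add_pow_comm, Matrix.mul_assoc ((W t)ᴴ * M t * W t) (R (t + 1)) (R (t + 1)), hRR]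

end Summit.QuantumFields.QCD.Cruxes.CriticalLineDiamagnetism.ChessboardCellGain
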